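import Summits.Ventures.QEC.CircuitDistance.ETowerZero
import Summits.Ventures.QEC.Census.CertCheckParityFast
import HarnessLib

/-!
# P3-PORT STEP 2 (E-fold tower): ZERO-FIBRE COMPLETENESS CERTIFICATES — brute-anchored checker + soundness (§B10)

The hypothesis `hD` of `ETowerZero.goodFibK_zero` («every half-word `c` of weight `≤ W/2` whose double lies in the big
kernel is `0` or a translate of a listed representative») from TRANSPARENT BRUTE FORCE with MIN-BLOCK ANCHORING (idea-1
ZERO-CERT §1): Bool data shapes `matchedB`, `zloop0 … zloop4` (VERBATIM the emitter's `List.range / List.all` nest: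
`zloopk M ok t acc lo n` = `∀ n > i₁ > … > i_k ≥ lo, M i₁ ⊕ … ⊕ M i_k = t → ok (acc ||| 2^{i₁} ||| … ||| 2^{i_k})`);
L1 `anchor_exists` (a nonzero word has a translate through the first slot of its least block, nothing below); L2/L3
`ZT_sound` (the nest covers every word of weight `k` above `lo`); ★ `zeroD_of_zcert`: the per-block, per-`k < h` facts
`zl k M (matchedB ls ms nb D) (M a) (2^a) (a+1) ns = true` give `hD` for every `W < 2(h+1)` (kernel ⇄ fibre table by
`kerK_doubleK_iff`; invariances `doubleK_transWK`, `popc_transWK`, `matchedK_of_matchedK_transWK`).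
Generic; no data; no `native_decide`; nothing here asserts a value of `d_circ` (cell `qec`, CDX, seat qec-cdx-type-1).
-/

set_option maxRecDepth 100000

namespace Summit.Ventures.QEC.CircuitDistance.ETower

open Summit.Ventures.QEC.Census Summit.Ventures.QEC.Census.Fold Finset

/-! ## The Bool data shapes (verbatim from idea-1's emitter) -/

/-- `matchedB l m nb D c`: some translate of the small word `c` is literally a listed representative (Bool `MatchedK`). -/
def matchedB (l m nb : ℕ) (D : List ℕ) (c : ℕ) : Bool :=
  D.any fun r => (List.range l).any fun da => (List.range m).any fun db => transWK l m nb da db c == r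

/-- 0 further slots: `t = 0 → ok acc`. -/
def zloop0 (_M : ℕ → ℕ) (ok : ℕ → Bool) (t acc _lo _n : ℕ) : Bool := (t != 0) || ok acc
/-- 1 further slot `i ∈ [lo, n)`: `M i = t → ok (acc ||| 2^i)`. -/
def zloop1 (M : ℕ → ℕ) (ok : ℕ → Bool) (t acc lo n : ℕ) : Bool :=
  (List.range n).all fun i => !(lo ≤ i) || (M i != t) || ok (acc ||| 2 ^ i)
/-- 2 further slots `n > i > j ≥ lo`. -/
def zloop2 (M : ℕ → ℕ) (ok : ℕ → Bool) (t acc lo n : ℕ) : Bool :=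
  (List.range n).all fun i => !(lo ≤ i) || (List.range i).all fun j => !(lo ≤ j) || (M i ^^^ M j != t) || ok (acc ||| 2 ^ i ||| 2 ^ j)
/-- 3 further slots `n > i > j > k ≥ lo`. -/
def zloop3 (M : ℕ → ℕ) (ok : ℕ → Bool) (t acc lo n : ℕ) : Bool :=
  (List.range n).all fun i => !(lo ≤ i) || (List.range i).all fun j => !(lo ≤ j) ||
    (List.range j).all fun k => !(lo ≤ k) || (M i ^^^ M j ^^^ M k != t) || ok (acc ||| 2 ^ i ||| 2 ^ j ||| 2 ^ k)
/-- 4 further slots `n > i > j > k > l ≥ lo`. -/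
def zloop4 (M : ℕ → ℕ) (ok : ℕ → Bool) (t acc lo n : ℕ) : Bool :=
  (List.range n).all fun i => !(lo ≤ i) || (List.range i).all fun j => !(lo ≤ j) ||
    (List.range j).all fun k => !(lo ≤ k) || (List.range k).all fun l => !(lo ≤ l) ||
      (M i ^^^ M j ^^^ M k ^^^ M l != t) || ok (acc ||| 2 ^ i ||| 2 ^ j ||| 2 ^ k ||| 2 ^ l)

/-- The nest with `k` further slots (`false` beyond 4). -/
def zl (k : ℕ) (M : ℕ → ℕ) (ok : ℕ → Bool) (t acc lo n : ℕ) : Bool :=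
  match k with
  | 0 => zloop0 M ok t acc lo n
  | 1 => zloop1 M ok t acc lo n
  | 2 => zloop2 M ok t acc lo n
  | 3 => zloop3 M ok t acc lo n
  | 4 => zloop4 M ok t acc lo n
  | _ => false

/-- `matchedB` decides `MatchedK`. -/
theorem matchedK_of_matchedB {l m nb : ℕ} {D : List ℕ} {c : ℕ} (h : matchedB l m nb D c = true) : MatchedK l m nb D c := by
  unfold matchedB at h
  obtain ⟨r, hr, h⟩ := List.any_eq_true.1 h
  obtain ⟨da, -, h⟩ := List.any_eq_true.1 h
  obtain ⟨db, -, h⟩ := List.any_eq_true.1 h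
  exact ⟨r, hr, da, db, eq_of_beq h⟩

/-! ## The semantic nest -/

/-- SEMANTIC NEST with prefix `p`: `ZT k p t acc lo n` = for all `n > i₁ > … > i_k ≥ lo`,
`p ⊕ M i₁ ⊕ … ⊕ M i_k = t → ok (acc ||| 2^{i₁} ||| … ||| 2^{i_k})`. -/
def ZT (M : ℕ → ℕ) (ok : ℕ → Bool) : ℕ → ℕ → ℕ → ℕ → ℕ → ℕ → Prop
  | 0, p, t, acc, _, _ => p = t → ok acc = true
  | k + 1, p, t, acc, lo, n => ∀ i, lo ≤ i → i < n → ZT M ok k (p ^^^ M i) t (acc ||| 2 ^ i) lo i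

section Bridge

variable {M : ℕ → ℕ} {ok : ℕ → Bool} {t acc lo n : ℕ}

/-- one guard level of the Bool nest. -/
private theorem guard_of_all {f : ℕ → Bool} {n lo i : ℕ} (h : ((List.range n).all fun i => !(lo ≤ i) || f i) = true)
    (hlo : lo ≤ i) (hi : i < n) : f i = true := by
  have := List.all_eq_true.1 h i (List.mem_range.2 hi)
  rw [Bool.or_eq_true] at this
  rcases this with h' | h'
  · rw [Bool.not_eq_true', decide_eq_false_iff_not] at h'; exact absurd hlo h'
  · exact h'

/-- the leaf test of the Bool nest. -/
private theorem leaf_of_or {x t : ℕ} {b : Bool} (h : ((x != t) || b) = true) (hx : x = t) : b = true := by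
  rw [Bool.or_eq_true] at h
  rcases h with h' | h'
  · rw [bne_iff_ne] at h'; exact absurd hx h'
  · exact h'

/-- `zloop0` ⇒ nest 0. -/
theorem zloop0_ZT (h : zloop0 M ok t acc lo n = true) : ZT M ok 0 0 t acc lo n := by
  intro hp
  unfold zloop0 at h
  exact leaf_of_or (x := t) (t := 0) h hp.symm

/-- `zloop1` ⇒ nest 1. -/
theorem zloop1_ZT (h : zloop1 M ok t acc lo n = true) : ZT M ok 1 0 t acc lo n := by
  intro i hlo hi hp
  unfold zloop1 at h
  have h1 := guard_of_all (f := fun i => (M i != t) || ok (acc ||| 2 ^ i)) (by simpa only [Bool.or_assoc] using h) hlo hi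
  rw [Nat.zero_xor] at hp
  exact leaf_of_or h1 hp

/-- `zloop2` ⇒ nest 2. -/
theorem zloop2_ZT (h : zloop2 M ok t acc lo n = true) : ZT M ok 2 0 t acc lo n := by
  intro i hloi hi j hloj hj hp
  unfold zloop2 at h
  have h1 := guard_of_all h hloi hi
  have h2 := guard_of_all (f := fun j => (M i ^^^ M j != t) || ok (acc ||| 2 ^ i ||| 2 ^ j))
    (by simpa only [Bool.or_assoc] using h1) hloj hj
  rw [Nat.zero_xor] at hp
  exact leaf_of_or h2 hp

/-- `zloop3` ⇒ nest 3. -/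
theorem zloop3_ZT (h : zloop3 M ok t acc lo n = true) : ZT M ok 3 0 t acc lo n := by
  intro i hloi hi j hloj hj k hlok hk hp
  unfold zloop3 at h
  have h1 := guard_of_all h hloi hi
  have h2 := guard_of_all h1 hloj hj
  have h3 := guard_of_all (f := fun k => (M i ^^^ M j ^^^ M k != t) || ok (acc ||| 2 ^ i ||| 2 ^ j ||| 2 ^ k))
    (by simpa only [Bool.or_assoc] using h2) hlok hk
  rw [Nat.zero_xor] at hp
  exact leaf_of_or h3 hp

/-- `zloop4` ⇒ nest 4. -/
theorem zloop4_ZT (h : zloop4 M ok t acc lo n = true) : ZT M ok 4 0 t acc lo n := by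
  intro i hloi hi j hloj hj k hlok hk l hlol hl hp
  unfold zloop4 at h
  have h1 := guard_of_all h hloi hi
  have h2 := guard_of_all h1 hloj hj
  have h3 := guard_of_all h2 hlok hk
  have h4 := guard_of_all (f := fun l => (M i ^^^ M j ^^^ M k ^^^ M l != t) || ok (acc ||| 2 ^ i ||| 2 ^ j ||| 2 ^ k ||| 2 ^ l))
    (by simpa only [Bool.or_assoc] using h3) hlol hl
  rw [Nat.zero_xor] at hp
  exact leaf_of_or h4 hp

/-- `zl k` ⇒ nest `k`. -/
theorem zl_ZT {k : ℕ} (h : zl k M ok t acc lo n = true) : ZT M ok k 0 t acc lo n := by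
  match k, h with
  | 0, h => exact zloop0_ZT h
  | 1, h => exact zloop1_ZT h
  | 2, h => exact zloop2_ZT h
  | 3, h => exact zloop3_ZT h
  | 4, h => exact zloop4_ZT h
  | _ + 5, h => exact absurd h (by simp [zl])

end Bridge

/-! ## Bit bookkeeping -/

/-- weight of a unit vector inside the window. -/
theorem popc_two_pow {n i : ℕ} (hi : i < n) : popc n (2 ^ i) = 1 := by
  rw [popc_eq_card]
  have : ({j ∈ range n | (2 ^ i).testBit j = true} : Finset ℕ) = {i} := by
    ext j
    simp only [mem_filter, mem_range, Nat.testBit_two_pow, decide_eq_true_eq, mem_singleton]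
    constructor
    · rintro ⟨-, h⟩; exact h.symm
    · rintro rfl; exact ⟨hi, rfl⟩
  rw [this, card_singleton]

/-- a word of weight 0 inside the window is 0. -/
theorem eq_zero_of_popc_eq_zero {n e : ℕ} (he : e < 2 ^ n) (hpc : popc n e = 0) : e = 0 := by
  rw [popc_eq_card, card_eq_zero, filter_eq_empty_iff] at hpc
  apply Nat.eq_of_testBit_eq
  intro i
  rw [Nat.zero_testBit]
  by_cases hi : i < n
  · have := hpc (mem_range.2 hi)
    cases h : e.testBit i
    · rfl
    · exact absurd h this
  · exact Nat.testBit_lt_two_pow (lt_of_lt_of_le he (Nat.pow_le_pow_right (by norm_num) (not_lt.1 hi)))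

/-- `lin` ignores absent high bits. -/
theorem lin_eq_lin_of_lt (g : ℕ → ℕ) {i n e : ℕ} (he : e < 2 ^ i) (hin : i ≤ n) : lin g n 0 e = lin g i 0 e := by
  rw [← maskOf_bitsOf_zero i e he,
    ← xorIdx_eq_lin g n _ (fun j hj => lt_of_lt_of_le (lt_of_mem_bitsOf hj) hin),
    ← xorIdx_eq_lin g i _ (fun j hj => lt_of_mem_bitsOf hj)]

/-- REMOVING A SET BIT `i` of `e` (`e₁ = e ⊕ 2^i`): or-decomposition, bits, weight and `lin`. -/
theorem split_bit {e i n : ℕ} (hbit : e.testBit i = true) (hin : i < n) :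
    (∀ acc : ℕ, acc ||| 2 ^ i ||| (e ^^^ 2 ^ i) = acc ||| e) ∧
    (∀ j, (e ^^^ 2 ^ i).testBit j = true → e.testBit j = true ∧ j ≠ i) ∧
    (e ^^^ 2 ^ i).testBit i = false ∧
    popc n e = popc n (e ^^^ 2 ^ i) + 1 ∧
    (∀ g : ℕ → ℕ, lin g n 0 e = lin g n 0 (e ^^^ 2 ^ i) ^^^ g i) := by
  have he : e = (e ^^^ 2 ^ i) ^^^ 2 ^ i := by rw [Nat.xor_assoc, Nat.xor_self, Nat.xor_zero]
  refine ⟨?_, ?_, ?_, ?_, ?_⟩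
  · intro acc
    apply Nat.eq_of_testBit_eq
    intro j
    rw [Nat.testBit_or, Nat.testBit_or, Nat.testBit_or, Nat.testBit_xor, Nat.testBit_two_pow]
    by_cases hj : i = j
    · subst hj; rw [hbit]; simp
    · simp [hj]
  · intro j hj
    rw [Nat.testBit_xor, Nat.testBit_two_pow] at hj
    by_cases h : i = j
    · subst h; rw [hbit] at hj; simp at hj
    · simp only [h, decide_false, Bool.xor_false] at hj
      exact ⟨hj, fun h' => h h'.symm⟩
  · rw [Nat.testBit_xor, Nat.testBit_two_pow, hbit]; simp
  · have hand : (e ^^^ 2 ^ i) &&& 2 ^ i = 0 := by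
      apply Nat.eq_of_testBit_eq
      intro j
      rw [Nat.testBit_and, Nat.testBit_xor, Nat.testBit_two_pow, Nat.zero_testBit]
      by_cases h : i = j
      · subst h; rw [hbit]; simp
      · simp [h]
    conv_lhs => rw [he]
    rw [popc_xor_of_and_eq_zero hand, popc_two_pow hin]
  · intro g
    conv_lhs => rw [he]
    rw [lin_xor, lin_two_pow g n 0 i hin, Nat.zero_add]

/-! ## Soundness of the nest -/

/-- ★ **NEST SOUNDNESS**: `ZT k p t acc lo n` proves, for every word `e < 2^n` of weight `k` with all bits `≥ lo` and
`p ⊕ (⊕_{i ∈ e} M i) = t`, that `ok (acc ||| e)`. -/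
theorem ZT_sound {M : ℕ → ℕ} {ok : ℕ → Bool} :
    ∀ (k p t acc lo n : ℕ), ZT M ok k p t acc lo n →
      ∀ e, e < 2 ^ n → (∀ i, e.testBit i = true → lo ≤ i) → popc n e = k → p ^^^ lin M n 0 e = t →
        ok (acc ||| e) = true
  | 0, p, t, acc, lo, n, h, e, he, _, hpc, hlin => by
    have he0 : e = 0 := eq_zero_of_popc_eq_zero he hpc
    subst he0
    rw [lin_zero, Nat.xor_zero] at hlin
    rw [Nat.or_zero]
    exact h hlin
  | k + 1, p, t, acc, lo, n, h, e, he, hlo, hpc, hlin => by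
    have hne : e ≠ 0 := by rintro rfl; rw [popc_zero] at hpc; exact absurd hpc (by omega)
    obtain ⟨i, hbit, hmax⟩ := Nat.exists_most_significant_bit hne
    have hin : i < n := by
      by_contra hh
      rw [Nat.testBit_lt_two_pow (lt_of_lt_of_le he (Nat.pow_le_pow_right (by norm_num) (not_lt.1 hh)))] at hbit
      exact Bool.false_ne_true hbit
    obtain ⟨hor, hbits, hbi, hpc', hlinsplit⟩ := split_bit hbit hin
    have he₁lt : e ^^^ 2 ^ i < 2 ^ i := by
      apply Nat.lt_pow_two_of_testBit
      intro j hj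
      cases hj' : (e ^^^ 2 ^ i).testBit j
      · rfl
      · obtain ⟨hej, hne⟩ := hbits j hj'
        rcases lt_or_eq_of_le hj with hlt | heq'
        · rw [hmax j hlt] at hej; exact absurd hej Bool.false_ne_true
        · exact absurd heq'.symm hne
    have hk : popc i (e ^^^ 2 ^ i) = k := by rw [← popc_eq_of_lt he₁lt hin.le]; omega
    have hlin₁ : (p ^^^ M i) ^^^ lin M i 0 (e ^^^ 2 ^ i) = t := by
      rw [← lin_eq_lin_of_lt M he₁lt hin.le, Nat.xor_assoc, Nat.xor_comm (M i), ← hlinsplit M]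
      exact hlin
    have ih := ZT_sound k (p ^^^ M i) t (acc ||| 2 ^ i) lo i (h i (hlo i hbit) hin) (e ^^^ 2 ^ i) he₁lt
      (fun j hj => hlo j (hbits j hj).1) hk hlin₁
    rwa [hor acc] at ih

/-! ## Anchoring -/

/-- ★ **MIN-BLOCK ANCHORING** (L1): a nonzero word on the `nb`-block torus has a translate containing the first slot of
some block `b < nb` and no slot below it. -/
theorem anchor_exists {l m nb c : ℕ} (hl : 0 < l) (hm : 0 < m) (hne : c ≠ 0) (hc : c < 2 ^ (nb * (l * m))) :
    ∃ da db b, b < nb ∧ (transWK l m nb da db c).testBit (b * (l * m)) = true ∧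
      ∀ i, (transWK l m nb da db c).testBit i = true → b * (l * m) ≤ i := by
  classical
  have hex : ∃ j, c.testBit j = true := by
    obtain ⟨i, hi, -⟩ := Nat.exists_most_significant_bit hne; exact ⟨i, hi⟩
  have hj0 : c.testBit (Nat.find hex) = true := Nat.find_spec hex
  have hj0min : ∀ i, i < Nat.find hex → c.testBit i = false := fun i hi => by
    have := Nat.find_min hex hi; simpa using this
  set j0 := Nat.find hex with hj0def
  have hj0lt : j0 < nb * (l * m) := by
    by_contra hh
    rw [Nat.testBit_lt_two_pow (lt_of_lt_of_le hc (Nat.pow_le_pow_right (by norm_num) (not_lt.1 hh)))] at hj0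
    exact Bool.false_ne_true hj0
  have ha : j0 % (l * m) / m < l := coord_a_lt hm hl
  have hb : j0 % (l * m) % m < m := coord_b_lt hm
  set da := l - j0 % (l * m) / m with hda
  set db := m - j0 % (l * m) % m with hdb
  have htr : transIdx l m da db j0 = j0 / (l * m) * (l * m) := by
    rw [transIdx_eq, show j0 % (l * m) / m + da = l by omega, show j0 % (l * m) % m + db = m by omega,
      Nat.mod_self, Nat.mod_self]
    omega
  refine ⟨da, db, j0 / (l * m), coord_blk_ltK hl hm hj0lt, ?_, ?_⟩
  · rw [← htr, testBit_transWK hl hm nb da db c hj0lt]; exact hj0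
  · intro i hi
    have hilt : i < nb * (l * m) := by
      by_contra hh
      rw [Nat.testBit_lt_two_pow (lt_of_lt_of_le (transWK_lt hl hm nb da db c)
        (Nat.pow_le_pow_right (by norm_num) (not_lt.1 hh)))] at hi
      exact Bool.false_ne_true hi
    -- the preimage slot
    set J := transIdx l m (l - da % l) (m - db % m) i with hJ
    have hJlt : J < nb * (l * m) := transIdx_ltK hl hm nb _ _ hilt
    have hJi : transIdx l m da db J = i := by
      rw [hJ, transIdx_comp hl hm, ← transIdx_mod (l := l) (m := m),
        show (da + (l - da % l)) % l = 0 by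
          have := Nat.mod_lt da hl; have := Nat.div_add_mod da l
          rw [show da + (l - da % l) = l * (da / l) + l by omega]; simp,
        show (db + (m - db % m)) % m = 0 by
          have := Nat.mod_lt db hm; have := Nat.div_add_mod db m
          rw [show db + (m - db % m) = m * (db / m) + m by omega]; simp,
        transIdx_zeroK hl hm]
    have hcJ : c.testBit J = true := by
      rw [← hJi, testBit_transWK hl hm nb da db c hJlt] at hi; exact hi
    have hJge : j0 ≤ J := by
      by_contra hh
      rw [hj0min J (not_le.1 hh)] at hcJ
      exact Bool.false_ne_true hcJ
    rw [← hJi, transIdx_eq]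
    have : j0 / (l * m) * (l * m) ≤ J / (l * m) * (l * m) := Nat.mul_le_mul_right _ (Nat.div_le_div_right hJge)
    omega

/-! ## ★ The certificate gives `hD` -/

/-- ★★ **ZERO-FIBRE D-LIST COMPLETENESS FROM THE BRUTE-ANCHORED CERTIFICATE.**  For a fold step `G` on `nb` blocks with
big column function `col` (kernel translation-invariant: `hK`) and fibre table `M j = col (emb j) ⊕ col (partner (emb j))`:
if for every block `b < nb` (anchor `a = b·ls·ms`) and every `k < h` the nest `zl k M (matchedB ls ms nb D) (M a) (2^a) (a+1) ns`
passes, then every half-word of weight `≤ W/2` (`W < 2(h+1)`) whose double is a big kernel word is `0` or matched in `D` —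
the hypothesis `hD` of `goodFibK_zero`. -/
theorem zeroD_of_zcert {G : Geo} {nb : ℕ} (hS : G.Shape) (hG : OKK G nb) {col M : ℕ → ℕ}
    (hM : ∀ j, j < nsK G nb → M j = col (G.emb j) ^^^ col (G.partner (G.emb j)))
    (hK : ∀ da db u, u < 2 ^ nK G nb → (kerK col (nK G nb) u ↔ kerK col (nK G nb) (transWK G.l G.m nb da db u)))
    {W h : ℕ} (hWh : W < 2 * (h + 1)) {D : List ℕ}
    (hz : ∀ b, b < nb → ∀ k, k < h →
      zl k M (matchedB G.ls G.ms nb D) (M (b * (G.ls * G.ms))) (2 ^ (b * (G.ls * G.ms))) (b * (G.ls * G.ms) + 1)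
        (nsK G nb) = true) :
    ∀ c, c < 2 ^ nsK G nb → 2 * popc (nsK G nb) c ≤ W → kerK col (nK G nb) (doubleK G nb c) →
      c = 0 ∨ MatchedK G.ls G.ms nb D c := by
  intro c hc hw hker
  rcases eq_or_ne c 0 with h0 | hne
  · exact Or.inl h0
  right
  have hls := hS.ls_pos
  have hms := hS.ms_pos
  have hns : nsK G nb = nb * (G.ls * G.ms) := rfl
  rw [hns] at hc hw hz
  -- anchor a translate
  obtain ⟨da, db, b, hb, hbit, hmin⟩ := anchor_exists hls hms hne hc
  set c' := transWK G.ls G.ms nb da db c with hc'def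
  have hc'lt : c' < 2 ^ (nb * (G.ls * G.ms)) := transWK_lt hls hms nb da db c
  have hpc : popc (nb * (G.ls * G.ms)) c' ≤ h := by
    rw [hc'def, popc_transWK hls hms]; omega
  -- its fibre-table syndrome vanishes
  have hkerM : lin M (nb * (G.ls * G.ms)) 0 c' = 0 := by
    have h1 : kerK col (nK G nb) (doubleK G nb c') := by
      rw [hc'def, ← doubleK_transWK hS hG]
      exact (hK da db _ (doubleK_lt hG c)).1 hker
    rw [kerK_doubleK_iff hG hM] at h1
    exact h1
  -- remove the anchor bit
  have hA : b * (G.ls * G.ms) < nb * (G.ls * G.ms) := by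
    by_contra hh
    rw [Nat.testBit_lt_two_pow (lt_of_lt_of_le hc'lt (Nat.pow_le_pow_right (by norm_num) (not_lt.1 hh)))] at hbit
    exact Bool.false_ne_true hbit
  obtain ⟨hor, hbits, hbi, hpc', hlinsplit⟩ := split_bit hbit hA
  have helt : c' ^^^ 2 ^ (b * (G.ls * G.ms)) < 2 ^ (nb * (G.ls * G.ms)) := by
    apply Nat.lt_pow_two_of_testBit
    intro j hj
    cases hj' : (c' ^^^ 2 ^ (b * (G.ls * G.ms))).testBit j
    · rfl
    · have := (hbits j hj').1
      rw [Nat.testBit_lt_two_pow (lt_of_lt_of_le hc'lt (Nat.pow_le_pow_right (by norm_num) hj))] at this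
      exact absurd this Bool.false_ne_true
  have hlo : ∀ i, (c' ^^^ 2 ^ (b * (G.ls * G.ms))).testBit i = true → b * (G.ls * G.ms) + 1 ≤ i := by
    intro i hi
    obtain ⟨hci, hne'⟩ := hbits i hi
    have := hmin i hci
    omega
  have hke : popc (nb * (G.ls * G.ms)) (c' ^^^ 2 ^ (b * (G.ls * G.ms))) < h := by omega
  have hlin : 0 ^^^ lin M (nb * (G.ls * G.ms)) 0 (c' ^^^ 2 ^ (b * (G.ls * G.ms))) = M (b * (G.ls * G.ms)) := by
    rw [Nat.zero_xor]
    rw [hlinsplit M] at hkerM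
    have := congrArg (· ^^^ M (b * (G.ls * G.ms))) hkerM
    simpa [Nat.xor_assoc] using this
  -- run the nest
  have hok := ZT_sound _ _ _ _ _ _ (zl_ZT (hz b hb _ hke)) _ helt hlo rfl hlin
  have hc'eq : 2 ^ (b * (G.ls * G.ms)) ||| (c' ^^^ 2 ^ (b * (G.ls * G.ms))) = c' := by
    have := hor 0; rwa [Nat.zero_or, Nat.zero_or] at this
  rw [hc'eq] at hok
  exact matchedK_of_matchedK_transWK hls hms (matchedK_of_matchedB hok)

end Summit.Ventures.QEC.CircuitDistance.ETower
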